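import Summits.CriticalPhenomena.PercolationContinuityZ3.Theorems.PercNearOneGluingNoHeavyQuantAD3FourAtomCell
import Summits.CriticalPhenomena.PercolationContinuityZ3.Theorems.PercNearOneGluingNoHeavyQuantAD3GateCellReduction
import Summits.CriticalPhenomena.PercolationContinuityZ3.Theorems.PercNearOneGluingNoHeavyQuantAD3ConvClosedTB
import HarnessLib

/-!
# QUANT lane R8, T-DEC, ROUTE 2: the gate cell `AD3GateTriple4` HOLDS — hence `AD3GateCell`, and the R8 tree row follows from
# the law-level product node `AD3ConvClosedTB` alone

builds on p205010 (kernel theorem, internal audit signed; external expert review pending)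

Support file (`--supports stmt-CriticalPhenomena-4575`), QUANT lane, seat prim-quant-arm-2 (gen 37), rung R8 of
`run/shared/lean/prim/quant/LADDER.md`.  Theorems only, standard axioms, no sorries.  Memo
`run/shared/lean/prim/quant/prim-quant-arm-2-g37/AD3-GATE4-G37.md`.

`LawDec.AD3GateTriple4` (typer g31, `…QuantAD3GateCellReduction`): the `q₀`-gate `ν = {0: 1−q₀, s₁: q₀p₁, s₂: q₀p₂, s₃: q₀p₃}` of an
admissible triple is AD3⁺-decomposable at `(y, q, q₀T, M)`.  This is the special case `ν = gate_{q₀}{s₁, s₂, s₃}`, mean `q₀T`, of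
`LawDec.ad3Decomp_fourAtom` (`…QuantAD3FourAtomCell`: EVERY admissible four-atom law with a zero atom is AD3⁺, because its admissible
set on the mean polygon is cut out by one half-plane); the cell's hypotheses `s₁ < q₀T`, "not heavy-decomposable" and `q₀ < 1` are
not used.  Consequences: `AD3GateCell` (typer g31's `ad3GateCell_of_triple4`), and `TreeBuiltAD3`, `FarTreeRow` from typer g32's law-level product
node `AD3ConvClosedTB` ALONE (`treeBuiltAD3_of_gateCell_convClosedTB`).  The component-level product cell `AD3ProdCell` is FALSE (this seat's
`LawDec.not_ad3ProdCell`, `…QuantAD3ProdCellRefutation`), so the earlier reading "`FarTreeRow` from `AD3ProdCell`" is vacuous and not stated.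

* **`LawDec.ad3GateTriple4_holds : AD3GateTriple4`**, **`LawDec.ad3GateCell_holds : AD3GateCell`**,
  `LawDec.treeBuiltAD3_of_convClosedTB : AD3ConvClosedTB → TreeBuiltAD3`, **`Quant.farTreeRow_of_convClosedTB : AD3ConvClosedTB → FarTreeRow`**.
HONEST STATUS: `AD3ConvClosedTB`, `TreeBuiltAD3`, `FarTreeRow` OPEN; RATE class log\* / honest sentence unchanged.

[this work] (this lane).  The gluing rows served [cite: KozmaNitzan2024, Conjecture 3 (p. 15)]; product measure [cite: Grimmett1999, §1.3 p. 10].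
-/

noncomputable section

namespace Summit.CriticalPhenomena.PercolationContinuityZ3.Theorems

namespace Quant

open Finset

/-- three-atom law notation `TR[s₁, s₂, s₃, p₁, p₂, p₃, h] = p₁·[h = s₁] + p₂·[h = s₂] + p₃·[h = s₃]`. -/
local notation3 "TR[" s₁ ", " s₂ ", " s₃ ", " p₁ ", " p₂ ", " p₃ ", " h "]" =>
  (p₁ : ℝ) * (if (h : ℕ) = (s₁ : ℕ) then (1 : ℝ) else 0) + (p₂ : ℝ) * (if (h : ℕ) = (s₂ : ℕ) then (1 : ℝ) else 0)
    + (p₃ : ℝ) * (if (h : ℕ) = (s₃ : ℕ) then (1 : ℝ) else 0)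

/-- four-atom law notation `QD[a, b, c, Z, A, B, C, h] = Z·[h = 0] + A·[h = a] + B·[h = b] + C·[h = c]`. -/
local notation3 "QD[" a ", " b ", " c ", " Z ", " A ", " B ", " C ", " h "]" =>
  (Z : ℝ) * (if (h : ℕ) = (0 : ℕ) then (1 : ℝ) else 0) + (A : ℝ) * (if (h : ℕ) = (a : ℕ) then (1 : ℝ) else 0)
    + (B : ℝ) * (if (h : ℕ) = (b : ℕ) then (1 : ℝ) else 0) + (C : ℝ) * (if (h : ℕ) = (c : ℕ) then (1 : ℝ) else 0)

namespace LawDec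

/-- the `q₀`-gate of a triple `{s₁, s₂, s₃}` is the four-atom law `(1 − q₀, q₀p₁, q₀p₂, q₀p₃)` on `{0, s₁, s₂, s₃}` (as mass
vectors; no hypothesis on the atoms is needed for the identity). [this work] -/
theorem gate_TR_eq_QD (s₁ s₂ s₃ : ℕ) (p₁ p₂ p₃ q₀ : ℝ) :
    gate (fun h => TR[s₁, s₂, s₃, p₁, p₂, p₃, h]) q₀ = fun h => QD[s₁, s₂, s₃, 1 - q₀, q₀ * p₁, q₀ * p₂, q₀ * p₃, h] := by
  funext h
  simp only [gate]
  split_ifs <;> ring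

/-- **THE GATE CELL `AD3GateTriple4` HOLDS** (special case of `ad3Decomp_fourAtom`). [this work] -/
theorem ad3GateTriple4_holds : AD3GateTriple4 := by
  intro y q q₀ T M s₁ s₂ s₃ p₁ p₂ p₃ hy0 hq0 hq1 hq₀0 hq₀1 hyqq hta hs h12 h23 h3 hp₁ hp₂ hp₃ hp hT _hs1T _hnotHD hD
  have hq₀1' : q₀ ≤ 1 := hq₀1.le
  have hyq : y < q := lt_of_lt_of_le hyqq (by nlinarith)
  rw [gate_TR_eq_QD s₁ s₂ s₃ p₁ p₂ p₃ q₀]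
  refine ad3Decomp_fourAtom y q (q₀ * T) M s₁ s₂ s₃ (1 - q₀) (q₀ * p₁) (q₀ * p₂) (q₀ * p₃) hs h12 h23 h3 hy0 hyq hq1
    (by linarith) (by positivity) (by positivity) (by positivity) (by linear_combination q₀ * hp) (by rw [← hT]; ring)
    (by nlinarith) ?_
  intro j' hj'
  rw [← gate_TR_eq_QD s₁ s₂ s₃ p₁ p₂ p₃ q₀, gate_gate]
  exact hD j' hj'

/-- **THE GATE CELL `AD3GateCell` HOLDS** (typer g31's reduction `ad3GateCell_of_triple4`). [this work] -/
theorem ad3GateCell_holds : AD3GateCell :=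
  ad3GateCell_of_triple4 ad3GateTriple4_holds

/-- **`AD3ConvClosedTB ⟹ TreeBuiltAD3`** — with the gate cell proved, typer g32's law-level product node `AD3ConvClosedTB` (tree-built factors,
all gates; `…QuantAD3ConvClosedTB`) is the only remaining hypothesis of the Route-2 tree induction.  (The component-level product cell `AD3ProdCell` is
FALSE: `LawDec.not_ad3ProdCell`, `…QuantAD3ProdCellRefutation`.) [this work] -/
theorem treeBuiltAD3_of_convClosedTB (hC : AD3ConvClosedTB) : TreeBuiltAD3 :=
  treeBuiltAD3_of_gateCell_convClosedTB ad3GateCell_holds hC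

end LawDec

/-- **`AD3ConvClosedTB ⟹ Quant.FarTreeRow`** — the R8 tree row through the tree-built AD3⁺ induction now rests on the law-level product node
ALONE.  CONDITIONAL on `AD3ConvClosedTB` (OPEN). [this work] -/
theorem farTreeRow_of_convClosedTB (hC : LawDec.AD3ConvClosedTB) : FarTreeRow :=
  farTreeRow_of_gateCell_convClosedTB LawDec.ad3GateCell_holds hC

end Quant

end Summit.CriticalPhenomena.PercolationContinuityZ3.Theorems
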